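import Literature.Probability.RandomPlanarGeometry.AffineInterp
import Summits.CriticalPhenomena.CardyFormulaZ2.Theorems.CardyQContinuationIsingJetsConformalStubPolygonLoopDistLe
import Mathlib.Topology.Algebra.Order.Floor
import Mathlib.Order.Monotone.Union

/-!
# Time changes between two closed polygons with close vertices
(route CardyQContinuation, serves stmt-CriticalPhenomena-5560: helper for the registered stub
`stub_design_meshQuad` of the n = 0 bridge of the crux `IsingJetsConformal`; generic)

Given knots `τ 0 < τ 1 < ⋯ < τ M = τ 0 + 1` we construct the **piecewise-affine time change**
`timeChange τ M : ℝ → ℝ` with `timeChange (a/M) = τ a`, affine on each `[a/M, (a+1)/M]`,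
continuous, strictly increasing, surjective and commuting with `t ↦ t + 1`
(`timeChange_spec`). Application (`dist_polygonLoop_inverse_le`): if the vertices of a closed
polygon `S` with `M` vertices are `C`-close to the points `polygonLoop l (τ a)` of another closed
polygon, which is affine between consecutive knots, then reparametrising `polygonLoop S` by the
inverse time change makes it pointwise `C`-close to `polygonLoop l`. [folklore]
-/

noncomputable section

namespace Summit.CriticalPhenomena.CardyFormulaZ2.Theorems.CardyQContinuation

namespace TimeChange

open Set Literature.Probability.RandomPlanarGeometry

variable (τ : ℕ → ℝ) (M : ℕ)

/-- The knots `τ 0, …, τ M` as a list. [folklore] -/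
def knots : List ℝ := (List.range (M + 1)).map τ

/-- Length of the knot list. [folklore] -/
@[simp] theorem length_knots : (knots τ M).length = M + 1 := by simp [knots]

/-- Entries of the knot list. [folklore] -/
@[simp] theorem getElem_knots {a : ℕ} (ha : a < (knots τ M).length) : (knots τ M)[a] = τ a := by
  simp [knots]

/-- The time change on one period: affine interpolation of the knots at the points `a/M`.
[folklore] -/
def base (s : ℝ) : ℝ := affineInterp (knots τ M) (M * s)

/-- **The time change**: `t ↦ ⌊t⌋ + base (fract t)`. [folklore] -/
def timeChange (t : ℝ) : ℝ := ⌊t⌋ + base τ M (Int.fract t)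

variable {τ M}

/-- The base map on the piece `[a/M, (a+1)/M]`. [folklore] -/
theorem base_apply_div (hM : 0 < M) {a : ℕ} (ha : a < M) {θ : ℝ} (hθ : θ ∈ Icc (0 : ℝ) 1) :
    base τ M ((a + θ) / M) = τ a + θ * (τ (a + 1) - τ a) := by
  have hMr : (0 : ℝ) < M := by exact_mod_cast hM
  rw [base, mul_div_cancel₀ _ hMr.ne',
    affineInterp_eq_lineMap (knots τ M) a (by simp; omega) ⟨by linarith [hθ.1], by linarith [hθ.2]⟩]
  simp only [getElem_knots, add_sub_cancel_left, AffineMap.lineMap_apply_ring']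
  ring

/-- The base map at the knots. [folklore] -/
theorem base_div (hM : 0 < M) {a : ℕ} (ha : a ≤ M) : base τ M (a / M) = τ a := by
  rcases Nat.lt_or_ge a M with h | h
  · have := base_apply_div (τ := τ) hM h (θ := 0) ⟨le_rfl, zero_le_one⟩
    simpa using this
  · have haM : a = M := le_antisymm ha h
    subst haM
    rcases Nat.exists_eq_succ_of_ne_zero hM.ne' with ⟨m, rfl⟩
    have := base_apply_div (τ := τ) hM (a := m) (Nat.lt_succ_self m) (θ := 1) ⟨zero_le_one, le_rfl⟩
    push_cast at this ⊢
    rw [this]; ring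

/-- The base map at `0` and `1`. [folklore] -/
theorem base_zero (hM : 0 < M) : base τ M 0 = τ 0 := by simpa using base_div (τ := τ) hM (Nat.zero_le M)

/-- The base map at `1`. [folklore] -/
theorem base_one (hM : 0 < M) : base τ M 1 = τ M := by
  have := base_div (τ := τ) hM le_rfl
  rwa [div_self (by exact_mod_cast hM.ne' : (M : ℝ) ≠ 0)] at this

/-- The base map is continuous. [folklore] -/
theorem continuous_base : Continuous (base τ M) :=
  (continuous_affineInterp _).comp (continuous_const.mul continuous_id)

/-- Every `s ∈ [0, 1]` lies on a piece: `s = (a + θ)/M` with `a < M`, `θ ∈ [0, 1]`. [folklore] -/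
theorem exists_piece (hM : 0 < M) {s : ℝ} (hs : s ∈ Icc (0 : ℝ) 1) :
    ∃ a : ℕ, a < M ∧ ∃ θ : ℝ, θ ∈ Icc (0 : ℝ) 1 ∧ s = (a + θ) / M := by
  have hMr : (0 : ℝ) < M := by exact_mod_cast hM
  set x : ℝ := M * s with hx
  have hx0 : 0 ≤ x := mul_nonneg hMr.le hs.1
  have hxM : x ≤ M := by rw [hx]; nlinarith [hs.2]
  rcases lt_or_eq_of_le hxM with hlt | heq
  · refine ⟨⌊x⌋₊, (Nat.floor_lt hx0).2 hlt, x - ⌊x⌋₊, ⟨sub_nonneg.2 (Nat.floor_le hx0),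
      by linarith [Nat.lt_floor_add_one x]⟩, ?_⟩
    rw [add_sub_cancel, hx, mul_div_cancel_left₀ _ hMr.ne']
  · have hs1 : s = 1 := by
      apply mul_left_cancel₀ hMr.ne'
      rw [mul_one, ← hx, heq]
    rcases Nat.exists_eq_succ_of_ne_zero hM.ne' with ⟨m, rfl⟩
    refine ⟨m, Nat.lt_succ_self m, 1, ⟨zero_le_one, le_rfl⟩, ?_⟩
    push_cast at hMr ⊢
    rw [hs1, div_self hMr.ne']

section Spec

variable (hM : 0 < M) (hτ : ∀ a, a < M → τ a < τ (a + 1)) (hτM : τ M = τ 0 + 1)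
include hM hτ

omit hM in
/-- The knots increase. [folklore] -/
theorem τ_mono {a b : ℕ} (hab : a ≤ b) (hb : b ≤ M) : τ a ≤ τ b := by
  induction b with
  | zero => rw [Nat.le_zero.1 hab]
  | succ b ih =>
    rcases Nat.eq_or_lt_of_le hab with rfl | hlt
    · exact le_rfl
    · exact (ih (Nat.lt_succ_iff.1 hlt) (by omega)).trans (hτ b (by omega)).le

/-- **The base map is strictly increasing on `[0, 1]`.** [folklore] -/
theorem strictMonoOn_base : StrictMonoOn (base τ M) (Icc 0 1) := by
  intro s hs s' hs' hss'
  obtain ⟨a, ha, θ, hθ, rfl⟩ := exists_piece hM hs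
  obtain ⟨a', ha', θ', hθ', rfl⟩ := exists_piece hM hs'
  have hMr : (0 : ℝ) < M := by exact_mod_cast hM
  rw [base_apply_div hM ha hθ, base_apply_div hM ha' hθ']
  have hd := hτ a ha
  have hd' := hτ a' ha'
  rw [div_lt_div_iff_of_pos_right hMr] at hss'
  rcases lt_trichotomy a a' with h | rfl | h
  · -- `τ a + θ Δ ≤ τ (a+1) ≤ τ a' ≤ τ a' + θ' Δ'`, strictly somewhere
    have h1 : τ a + θ * (τ (a + 1) - τ a) ≤ τ (a + 1) := by nlinarith [hθ.2]
    have h2 : τ (a + 1) ≤ τ a' := τ_mono hτ h ha'.le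
    have h3 : τ a' ≤ τ a' + θ' * (τ (a' + 1) - τ a') := by nlinarith [hθ'.1]
    rcases lt_or_eq_of_le hθ'.1 with hpos | hzero
    · calc τ a + θ * (τ (a + 1) - τ a) ≤ τ a' := h1.trans h2
        _ < τ a' + θ' * (τ (a' + 1) - τ a') := by nlinarith
    · -- `θ' = 0`: then `θ < 1` or `a + 1 < a'`
      subst hzero
      rcases lt_or_eq_of_le hθ.2 with hθ1 | rfl
      · calc τ a + θ * (τ (a + 1) - τ a) < τ (a + 1) := by nlinarith
          _ ≤ τ a' + 0 * (τ (a' + 1) - τ a') := by linarith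
      · have : a + 1 < a' := by
          by_contra hc
          have : a' = a + 1 := by omega
          subst this; push_cast at hss'; linarith
        calc τ a + 1 * (τ (a + 1) - τ a) = τ (a + 1) := by ring
          _ < τ (a + 1 + 1) := hτ _ (by omega)
          _ ≤ τ a' + 0 * (τ (a' + 1) - τ a') := by
            have := τ_mono hτ (show a + 1 + 1 ≤ a' by omega) ha'.le; linarith
  · have : θ < θ' := by linarith
    nlinarith
  · exfalso
    have : (a' : ℝ) + 1 ≤ a := by exact_mod_cast h
    linarith [hθ.1, hθ'.2]

include hτM

/-- **Specification of the time change.** [folklore] -/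
theorem timeChange_spec :
    Continuous (timeChange τ M) ∧ StrictMono (timeChange τ M) ∧ Function.Surjective (timeChange τ M) ∧
      (∀ t, timeChange τ M (t + 1) = timeChange τ M t + 1) ∧
      (∀ a : ℕ, a < M → ∀ θ : ℝ, θ ∈ Icc (0 : ℝ) 1 → timeChange τ M ((a + θ) / M) = τ a + θ * (τ (a + 1) - τ a)) := by
  have hMr : (0 : ℝ) < M := by exact_mod_cast hM
  have h0 := base_zero (τ := τ) hM
  have h1 := base_one (τ := τ) hM
  -- continuity: `timeChange t = t + g (fract t)` with `g s = base s - s`, `g 0 = g 1`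
  have hcont : Continuous (timeChange τ M) := by
    have hg : Continuous ((fun s ↦ base τ M s - s) ∘ Int.fract) := by
      refine ContinuousOn.comp_fract'' (continuous_base.sub continuous_id).continuousOn ?_
      simp only [h0, h1, hτM]; ring
    have : timeChange τ M = fun t ↦ t + ((fun s ↦ base τ M s - s) ∘ Int.fract) t := by
      ext t
      simp only [timeChange, Function.comp_apply]
      rw [← Int.floor_add_fract t]
      simp only [Int.floor_add_fract]
      linarith [Int.floor_add_fract t]
    rw [this]
    exact continuous_id.add hg
  have hper : ∀ t, timeChange τ M (t + 1) = timeChange τ M t + 1 := by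
    intro t
    simp only [timeChange, Int.floor_add_one, Int.fract_add_one, Int.cast_add, Int.cast_one]
    ring
  have hmono : StrictMono (timeChange τ M) := by
    have hsm := strictMonoOn_base hM hτ
    intro t t' htt'
    simp only [timeChange]
    have hft : Int.fract t ∈ Icc (0 : ℝ) 1 := ⟨Int.fract_nonneg t, (Int.fract_lt_one t).le⟩
    have hft' : Int.fract t' ∈ Icc (0 : ℝ) 1 := ⟨Int.fract_nonneg t', (Int.fract_lt_one t').le⟩
    rcases lt_or_eq_of_le (Int.floor_mono htt'.le) with hlt | heq
    · -- different periods
      have hb1 : base τ M (Int.fract t) < base τ M 1 :=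
        hsm hft ⟨zero_le_one, le_rfl⟩ (Int.fract_lt_one t)
      have hb0 : base τ M 0 ≤ base τ M (Int.fract t') :=
        hsm.monotoneOn ⟨le_rfl, zero_le_one⟩ hft' (Int.fract_nonneg t')
      have hfl : (⌊t⌋ : ℝ) + 1 ≤ ⌊t'⌋ := by exact_mod_cast hlt
      rw [h1, hτM] at hb1; rw [h0] at hb0
      linarith
    · rw [heq]
      have : Int.fract t < Int.fract t' := by
        have e1 := Int.floor_add_fract t
        have e2 := Int.floor_add_fract t'
        rw [heq] at e1
        linarith
      linarith [hsm hft hft' this]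
  have hsurj : Function.Surjective (timeChange τ M) := by
    -- `timeChange t - t` is bounded (continuous periodic), so `timeChange → ±∞`
    obtain ⟨B, hB⟩ : ∃ B, ∀ s ∈ Icc (0 : ℝ) 1, |base τ M s - s| ≤ B := by
      obtain ⟨B, hB⟩ := isCompact_Icc.exists_bound_of_continuousOn
        ((continuous_base (τ := τ) (M := M)).sub continuous_id).continuousOn
      exact ⟨B, fun s hs ↦ by simpa [Real.norm_eq_abs] using hB s hs⟩
    have hbd : ∀ t, |timeChange τ M t - t| ≤ B := by
      intro t
      have hft : Int.fract t ∈ Icc (0 : ℝ) 1 := ⟨Int.fract_nonneg t, (Int.fract_lt_one t).le⟩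
      have := hB _ hft
      have e := Int.floor_add_fract t
      simp only [timeChange]
      calc |↑⌊t⌋ + base τ M (Int.fract t) - t| = |base τ M (Int.fract t) - Int.fract t| := by
            congr 1; linarith
        _ ≤ B := this
    refine (hcont.surjective ?_ ?_)
    · refine Filter.tendsto_atTop_mono (fun t ↦ ?_) (Filter.tendsto_atTop_add_const_right _ (-B) Filter.tendsto_id)
      have := hbd t; rw [abs_le] at this; simp only [id]; linarith
    · refine Filter.tendsto_atBot_mono (fun t ↦ ?_) (Filter.tendsto_atBot_add_const_right _ B Filter.tendsto_id)
      have := hbd t; rw [abs_le] at this; simp only [id]; linarith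
  refine ⟨hcont, hmono, hsurj, hper, fun a ha θ hθ ↦ ?_⟩
  -- the piece formula
  have hs : (a + θ) / M ∈ Icc (0 : ℝ) 1 := by
    constructor
    · exact div_nonneg (by linarith [hθ.1]) hMr.le
    · rw [div_le_one hMr]
      have : (a : ℝ) + 1 ≤ M := by exact_mod_cast ha
      linarith [hθ.2]
  rcases lt_or_eq_of_le hs.2 with hlt | heq
  · simp only [timeChange, Int.floor_eq_zero_iff.2 ⟨hs.1, hlt⟩, Int.cast_zero, zero_add,
      Int.fract_eq_self.2 ⟨hs.1, hlt⟩]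
    exact base_apply_div hM ha hθ
  · have hθ1 : θ = 1 := by
      rw [div_eq_one_iff_eq hMr.ne'] at heq
      have : (a : ℝ) + 1 ≤ M := by exact_mod_cast ha
      nlinarith [hθ.2]
    have haM : a + 1 = M := by
      rw [div_eq_one_iff_eq hMr.ne', hθ1] at heq
      exact_mod_cast heq
    subst hθ1
    rw [heq]
    simp only [timeChange, Int.floor_one, Int.cast_one, Int.fract_one, h0, one_mul]
    rw [haM, hτM]; ring

end Spec

/-! ### Reparametrising a close polygon -/

/-- **Two closed polygons, one reparametrised by the inverse time change, are pointwise close.**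
Let `S` have `M ≥ 1` vertices, let the knots `τ` be as above, let `φ` be inverse to the time
change (`timeChange τ M (φ u) = u`). If `dist S[a % M] (polygonLoop l (τ a)) ≤ C` for `a ≤ M` and
`polygonLoop l` is affine between consecutive knots, then
`dist (polygonLoop S (φ u)) (polygonLoop l u) ≤ C` for all `u`. [folklore] -/
theorem dist_polygonLoop_inverse_le {S l : List ℂ} {C : ℝ} (hM : 0 < M) (hSM : S.length = M)
    (hτ : ∀ a, a < M → τ a < τ (a + 1)) (hτM : τ M = τ 0 + 1)
    {φ : ℝ → ℝ} (hφ : ∀ u, timeChange τ M (φ u) = u)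
    (hclose : ∀ a : ℕ, a ≤ M → dist (S[a % M]'(by rw [hSM]; exact Nat.mod_lt _ hM)) (polygonLoop l (τ a)) ≤ C)
    (haff : ∀ a : ℕ, a < M → ∀ θ : ℝ, θ ∈ Icc (0 : ℝ) 1 →
      polygonLoop l (τ a + θ * (τ (a + 1) - τ a)) =
        AffineMap.lineMap (polygonLoop l (τ a)) (polygonLoop l (τ (a + 1))) θ) (u : ℝ) :
    dist (polygonLoop S (φ u)) (polygonLoop l u) ≤ C := by
  obtain ⟨hcont, hmono, hsurj, hper, hpiece⟩ := timeChange_spec hM hτ hτM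
  have hMr : (0 : ℝ) < M := by exact_mod_cast hM
  -- `φ` commutes with integer translations
  have hφper : ∀ u (z : ℤ), φ (u + z) = φ u + z := by
    intro u z
    apply hmono.injective
    rw [hφ]
    have : ∀ (t : ℝ) (z : ℤ), timeChange τ M (t + z) = timeChange τ M t + z := by
      intro t z
      induction z using Int.induction_on with
      | zero => simp
      | succ k ih => push_cast at ih ⊢; rw [← add_assoc, hper, ih]; ring
      | pred k ih =>
        push_cast at ih ⊢
        have := hper (t + (-(k : ℝ) - 1))
        rw [show t + (-(k : ℝ) - 1) + 1 = t + -k by ring, ih] at this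
        linarith
    rw [this, hφ]
  -- reduce to `u ∈ [τ 0, τ 0 + 1)` using the periodicity of both sides
  set z : ℤ := ⌊u - τ 0⌋ with hz
  set u' := u - z with hu'
  have hu'0 : τ 0 ≤ u' := by have := Int.floor_le (u - τ 0); rw [hu']; linarith
  have hu'1 : u' < τ 0 + 1 := by have := Int.lt_floor_add_one (u - τ 0); rw [hu']; linarith
  have e1 : polygonLoop l u = polygonLoop l u' := by
    rw [hu']
    simpa using ((periodic_polygonLoop l).sub_int_mul_eq z (x := u)).symm
  have hφu' : φ u' = φ u - z := by
    rw [hu', sub_eq_add_neg, show -(z : ℝ) = ((-z : ℤ) : ℝ) by push_cast; ring, hφper]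
    push_cast; ring
  have e2 : polygonLoop S (φ u) = polygonLoop S (φ u') := by
    rw [hφu']
    simpa using ((periodic_polygonLoop S).sub_int_mul_eq z (x := φ u)).symm
  rw [e1, e2]
  -- locate the knot interval of `u'`: `s := φ u' ∈ [0, 1]`, on the piece `a`
  have hs0 : 0 ≤ φ u' := by
    by_contra h
    push Not at h
    have := hmono h
    rw [hφ, show (0 : ℝ) = ((0 : ℕ) + (0 : ℝ)) / M by simp, hpiece 0 hM 0 ⟨le_rfl, zero_le_one⟩] at this
    simp at this; linarith
  have hs1 : φ u' ≤ 1 := by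
    by_contra h
    push Not at h
    have := hmono h
    rcases Nat.exists_eq_succ_of_ne_zero hM.ne' with ⟨m, hm⟩
    have hmm : m < M := by omega
    have h1 : timeChange τ M 1 = τ M := by
      have := hpiece m hmm 1 ⟨zero_le_one, le_rfl⟩
      rw [show ((m : ℝ) + 1) / M = 1 by rw [div_eq_one_iff_eq hMr.ne']; exact_mod_cast hm.symm] at this
      rw [this, show m + 1 = M from hm.symm]; ring
    rw [hφ, h1, hτM] at this; linarith
  obtain ⟨a, ha, θ, hθ, hsa⟩ := exists_piece hM ⟨hs0, hs1⟩
  have hu'eq : u' = τ a + θ * (τ (a + 1) - τ a) := by rw [← hφ u', hsa, hpiece a ha θ hθ]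
  have haS : a < S.length := by rw [hSM]; exact ha
  rw [hsa, hu'eq, haff a ha θ hθ, ← hSM, polygonLoop_apply_div haS hθ]
  refine PolygonLoopDistLe.dist_lineMap_lineMap_le hθ.1 hθ.2 ?_ ?_
  · have := hclose a ha.le
    simp only [Nat.mod_eq_of_lt ha] at this
    exact this
  · have := hclose (a + 1) ha
    simp only [hSM] at this ⊢
    convert this using 2

end TimeChange

end Summit.CriticalPhenomena.CardyFormulaZ2.Theorems.CardyQContinuation
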